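import Literature.Combinatorics.Optimization.PerfectGraphStableSetLP
import Literature.Computability.Complexity.MonotoneMatchingKWDepth
import HarnessLib

/-!
# The clique-versus-stable-set problem has a deterministic protocol of depth `O(log² n)`
# (Yannakakis 1991, Lemma 1) — PROVED, as a protocol tree

Source: M. Yannakakis, *Expressing combinatorial optimization problems by linear programs*,
J. Comput. System Sci. 43 (1991) 441–466 [Yannakakis1991] (held, `paper:doi-10-1145-62212-62232`),
§5, Lemma 1 (p. 462): "If the unambiguous communication complexity of a predicate is `g`, then its
deterministic complexity is at most `O(g²)`", proved through the protocol for the predicate `Q` of a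
graph ("is the clique `K` disjoint from the independent set `I`?") quoted in full in the module
docstring of `Literature/Combinatorics/Optimization/PerfectGraphStableSetLP.lean`, which records the
protocol as the rectangle partition it induces (what Theorem 5 consumes). This companion file records
it as an honest PROTOCOL TREE in the tree's model `DetProtocol` (binary Alice/Bob nodes, `run`,
`depth`; `DisjointnessRandomizedCommunication.lean`), with the cost bound:

* `DetProtocol.aliceSend k f` / `bobSend` — sending a `k`-bit string (`Fin k → Bool`) bit by bit
  (depth `k`, `run = f x`); `DetProtocol.aliceTell` / `bobTell` — announcing an element of a finite
  type `γ` with `|γ| ≤ 2^b` through an injective `b`-bit code (`binCode`), followed by a continuation;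
* `cisProtocol G fuel W` — Yannakakis' stages on the window `W`: Alice announces her least
  low-degree clique node in `W` (an element of `Option (Fin n)`, `⌊log₂(n+1)⌋+1` bits), Bob answers one
  bit (`v ∈ S`: the sets meet) or the stage recurses on `W ∩ N(v)`; if Alice has none, Bob announces
  his least high-degree stable node `w`, Alice answers one bit (`w ∈ K`) or the stage recurses on
  `W ∖ N[w]`; if neither exists the protocol accepts ("`K ∩ I = ∅` because of the degrees");
* `run_cisProtocol` — on a clique `K` and a stable set `S` the protocol outputs `true` iff
  `K ∩ S ∩ W = ∅` (the window lemmas of `PerfectGraphStableSetLP.lean`);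
* `depth_cisProtocol_le` — depth `≤ (2(⌊log₂(n+1)⌋+1) + 1) · ⌊log₂(2|W|)⌋`: each stage costs at most
  two announcements and one bit and halves the window ("Since every stage removes half of the nodes,
  there are at most `g` stages, and the communication per stage is obviously `O(g)`");
* `Yannakakis1991_lemma1_protocol` — for every graph `G` on `n` nodes a deterministic protocol for
  `Q` of depth `≤ (2⌊log₂(n+1)⌋ + 3) · ⌊log₂ 2n⌋ = O(log² n)`.

No new notion beyond protocol plumbing; no named fact. The general reduction of Lemma 1 (any
unambiguous cover ↦ `Q` on the rectangle graph) is `Yannakakis1991_lemma1` in the companion file.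
-/

noncomputable section

namespace Literature.Computability.Complexity

open Finset
open Literature.Combinatorics.Optimization.CliqueStableSet

namespace DetProtocol

variable {X Y β : Type*}

/-! ### Sending several bits -/

/-- Alice sends the `k`-bit string `f x`, most significant bit first; the leaves return the string.
[cite: Yannakakis1991, §5, proof of Lemma 1 ("the clique side sends a node", p. 462)] -/
def aliceSend : (k : ℕ) → (X → (Fin k → Bool)) → DetProtocol X Y (Fin k → Bool)
  | 0, _ => leaf fun i => i.elim0
  | k + 1, f =>
      alice (fun x => f x 0)
        ((aliceSend k fun x => Fin.tail (f x)).bind fun bs => leaf (Fin.cons false bs : Fin (k + 1) → Bool))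
        ((aliceSend k fun x => Fin.tail (f x)).bind fun bs => leaf (Fin.cons true bs : Fin (k + 1) → Bool))

/-- Bob sends the `k`-bit string `g y`. [cite: Yannakakis1991, §5, proof of Lemma 1 ("the independent side sends a node", p. 462)] -/
def bobSend : (k : ℕ) → (Y → (Fin k → Bool)) → DetProtocol X Y (Fin k → Bool)
  | 0, _ => leaf fun i => i.elim0
  | k + 1, g =>
      bob (fun y => g y 0)
        ((bobSend k fun y => Fin.tail (g y)).bind fun bs => leaf (Fin.cons false bs : Fin (k + 1) → Bool))
        ((bobSend k fun y => Fin.tail (g y)).bind fun bs => leaf (Fin.cons true bs : Fin (k + 1) → Bool))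

/-- `aliceSend` delivers `f x`. [cite: Yannakakis1991, §5, proof of Lemma 1 (p. 462)] -/
theorem run_aliceSend : ∀ (k : ℕ) (f : X → (Fin k → Bool)) (x : X) (y : Y),
    (aliceSend k f : DetProtocol X Y _).run x y = f x
  | 0, f, x, y => Subsingleton.elim _ _
  | k + 1, f, x, y => by
      simp only [aliceSend, run]
      cases h : f x 0
      · simp only [Bool.false_eq_true, if_false, run_bind, run, run_aliceSend k]
        rw [← h, Fin.cons_self_tail]
      · simp only [if_true, run_bind, run, run_aliceSend k]
        rw [← h, Fin.cons_self_tail]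

/-- `bobSend` delivers `g y`. [cite: Yannakakis1991, §5, proof of Lemma 1 (p. 462)] -/
theorem run_bobSend : ∀ (k : ℕ) (g : Y → (Fin k → Bool)) (x : X) (y : Y),
    (bobSend k g : DetProtocol X Y _).run x y = g y
  | 0, g, x, y => Subsingleton.elim _ _
  | k + 1, g, x, y => by
      simp only [bobSend, run]
      cases h : g y 0
      · simp only [Bool.false_eq_true, if_false, run_bind, run, run_bobSend k]
        rw [← h, Fin.cons_self_tail]
      · simp only [if_true, run_bind, run, run_bobSend k]
        rw [← h, Fin.cons_self_tail]

/-- `aliceSend k` has depth `≤ k`. [cite: Yannakakis1991, §5, proof of Lemma 1 (p. 463, "the communication per stage is obviously O(g)")] -/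
theorem depth_aliceSend_le : ∀ (k : ℕ) (f : X → (Fin k → Bool)),
    (aliceSend k f : DetProtocol X Y _).depth ≤ k
  | 0, f => by simp [aliceSend, depth]
  | k + 1, f => by
      simp only [aliceSend, depth]
      have h := depth_bind_le (X := X) (Y := Y)
        (fun bs : Fin k → Bool => leaf (Fin.cons false bs : Fin (k + 1) → Bool))
        (d := 0) (fun _ => by simp [depth]) (aliceSend k fun x => Fin.tail (f x))
      have h' := depth_bind_le (X := X) (Y := Y)
        (fun bs : Fin k → Bool => leaf (Fin.cons true bs : Fin (k + 1) → Bool))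
        (d := 0) (fun _ => by simp [depth]) (aliceSend k fun x => Fin.tail (f x))
      have ih := depth_aliceSend_le k fun x => Fin.tail (f x)
      omega

/-- `bobSend k` has depth `≤ k`. [cite: Yannakakis1991, §5, proof of Lemma 1 (p. 463)] -/
theorem depth_bobSend_le : ∀ (k : ℕ) (g : Y → (Fin k → Bool)),
    (bobSend k g : DetProtocol X Y _).depth ≤ k
  | 0, g => by simp [bobSend, depth]
  | k + 1, g => by
      simp only [bobSend, depth]
      have h := depth_bind_le (X := X) (Y := Y)
        (fun bs : Fin k → Bool => leaf (Fin.cons false bs : Fin (k + 1) → Bool))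
        (d := 0) (fun _ => by simp [depth]) (bobSend k fun y => Fin.tail (g y))
      have h' := depth_bind_le (X := X) (Y := Y)
        (fun bs : Fin k → Bool => leaf (Fin.cons true bs : Fin (k + 1) → Bool))
        (d := 0) (fun _ => by simp [depth]) (bobSend k fun y => Fin.tail (g y))
      have ih := depth_bobSend_le k fun y => Fin.tail (g y)
      omega

/-! ### Announcing an element of a finite type -/

variable {γ : Type*} [Fintype γ]

/-- An injective `b`-bit code of a finite type with at most `2^b` elements. [folklore] -/
def binCode (b : ℕ) (h : Fintype.card γ ≤ 2 ^ b) : γ ↪ (Fin b → Bool) :=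
  (Function.Embedding.nonempty_iff_card_le.2 (by simpa using h)).some

variable [Nonempty γ]

/-- Alice announces `f x ∈ γ` in `b` bits and the protocol continues with `cont (f x)`.
[cite: Yannakakis1991, §5, proof of Lemma 1 (p. 462)] -/
def aliceTell (b : ℕ) (h : Fintype.card γ ≤ 2 ^ b) (f : X → γ) (cont : γ → DetProtocol X Y β) :
    DetProtocol X Y β :=
  (aliceSend b fun x => binCode b h (f x)).bind fun bs => cont (Function.invFun (binCode b h) bs)

/-- Bob announces `g y ∈ γ` in `b` bits and the protocol continues with `cont (g y)`.
[cite: Yannakakis1991, §5, proof of Lemma 1 (p. 462)] -/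
def bobTell (b : ℕ) (h : Fintype.card γ ≤ 2 ^ b) (g : Y → γ) (cont : γ → DetProtocol X Y β) :
    DetProtocol X Y β :=
  (bobSend b fun y => binCode b h (g y)).bind fun bs => cont (Function.invFun (binCode b h) bs)

/-- Run law of `aliceTell`. [cite: Yannakakis1991, §5, proof of Lemma 1 (p. 462)] -/
theorem run_aliceTell (b : ℕ) (h : Fintype.card γ ≤ 2 ^ b) (f : X → γ) (cont : γ → DetProtocol X Y β)
    (x : X) (y : Y) : (aliceTell b h f cont).run x y = (cont (f x)).run x y := by
  rw [aliceTell, run_bind, run_aliceSend, Function.leftInverse_invFun (binCode b h).injective]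

/-- Run law of `bobTell`. [cite: Yannakakis1991, §5, proof of Lemma 1 (p. 462)] -/
theorem run_bobTell (b : ℕ) (h : Fintype.card γ ≤ 2 ^ b) (g : Y → γ) (cont : γ → DetProtocol X Y β)
    (x : X) (y : Y) : (bobTell b h g cont).run x y = (cont (g y)).run x y := by
  rw [bobTell, run_bind, run_bobSend, Function.leftInverse_invFun (binCode b h).injective]

/-- Depth law of `aliceTell`. [cite: Yannakakis1991, §5, proof of Lemma 1 (p. 463)] -/
theorem depth_aliceTell_le (b : ℕ) (h : Fintype.card γ ≤ 2 ^ b) (f : X → γ)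
    (cont : γ → DetProtocol X Y β) {d : ℕ} (hd : ∀ c, (cont c).depth ≤ d) :
    (aliceTell b h f cont).depth ≤ b + d :=
  (depth_bind_le _ (fun _ => hd _) _).trans (Nat.add_le_add_right (depth_aliceSend_le _ _) _)

/-- Depth law of `bobTell`. [cite: Yannakakis1991, §5, proof of Lemma 1 (p. 463)] -/
theorem depth_bobTell_le (b : ℕ) (h : Fintype.card γ ≤ 2 ^ b) (g : Y → γ)
    (cont : γ → DetProtocol X Y β) {d : ℕ} (hd : ∀ c, (cont c).depth ≤ d) :
    (bobTell b h g cont).depth ≤ b + d :=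
  (depth_bind_le _ (fun _ => hd _) _).trans (Nat.add_le_add_right (depth_bobSend_le _ _) _)

end DetProtocol

/-! ### The protocol for `Q` -/

open DetProtocol

variable {n : ℕ} (G : SimpleGraph (Fin n)) [DecidableRel G.Adj]

/-- Bits needed to name a node of `G` or say "none": `⌊log₂(n+1)⌋ + 1`. [cite: Yannakakis1991, §5, proof of Lemma 1 (p. 462–463)] -/
def nodeBits (n : ℕ) : ℕ := Nat.log 2 (n + 1) + 1

/-- `|Option (Fin n)| = n + 1 ≤ 2^{⌊log₂(n+1)⌋+1}`. [folklore] -/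
private theorem card_option_fin_le (n : ℕ) : Fintype.card (Option (Fin n)) ≤ 2 ^ nodeBits n := by
  rw [Fintype.card_option, Fintype.card_fin]
  exact (Nat.lt_pow_succ_log_self one_lt_two (n + 1)).le

/-- The announcement of a side: its least admissible node inside `A`, if any. [cite: Yannakakis1991, §5, proof of Lemma 1 (p. 462)] -/
def leastIn (A T : Finset (Fin n)) : Option (Fin n) :=
  if h : (T ∩ A).Nonempty then some ((T ∩ A).min' h) else none

/-- **Yannakakis' protocol for `Q` on the window `W`** (with `fuel` bounding the number of stages;
`fuel ≥ |W|` suffices): see the module docstring. Output `true` = "`K` and `S` are disjoint inside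
`W`". [cite: Yannakakis1991, §5, proof of Lemma 1 (p. 462–463)] -/
def cisProtocol : ℕ → Finset (Fin n) → DetProtocol (Finset (Fin n)) (Finset (Fin n)) Bool
  | 0, _ => leaf true
  | fuel + 1, W =>
      if W = ∅ then leaf true
      else
        aliceTell (nodeBits n) (card_option_fin_le n) (fun K => leastIn (lowSet G W) K) fun a =>
          match a with
          | some v =>
              -- Bob: does `v ∈ S`? (yes: the sets meet) — else continue on `W ∩ N(v)`
              bob (fun S => decide (v ∈ S))
                (if v ∈ lowSet G W then cisProtocol fuel (nbrWindow G W v) else leaf true)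
                (leaf false)
          | none =>
              bobTell (nodeBits n) (card_option_fin_le n) (fun S => leastIn (highSet G W) S) fun c =>
                match c with
                | some w =>
                    -- Alice: does `w ∈ K`? (yes: the sets meet) — else continue on `W ∖ N[w]`
                    alice (fun K => decide (w ∈ K))
                      (if w ∈ highSet G W then cisProtocol fuel (coNbrWindow G W w) else leaf true)
                      (leaf false)
                | none => leaf true

variable {G}

/-- **Correctness**: on a clique `K` and a stable set `S`, with `|W| ≤ fuel`, the protocol outputs
`true` iff `K ∩ S ∩ W = ∅`. [cite: Yannakakis1991, §5, proof of Lemma 1 (p. 462–463)] -/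
theorem run_cisProtocol {K S : Finset (Fin n)} (hK : G.IsClique (K : Set (Fin n)))
    (hS : ∀ i ∈ S, ∀ j ∈ S, ¬G.Adj i j) :
    ∀ (fuel : ℕ) (W : Finset (Fin n)), W.card ≤ fuel →
      (cisProtocol G fuel W).run K S = decide (K ∩ S ∩ W = ∅)
  | 0, W, hW => by
      have hW0 : W = ∅ := card_eq_zero.1 (Nat.le_zero.1 hW)
      subst hW0
      simp [cisProtocol, DetProtocol.run]
  | fuel + 1, W, hW => by
      by_cases hW0 : W = ∅
      · subst hW0
        simp [cisProtocol, DetProtocol.run]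
      rw [cisProtocol, if_neg hW0, run_aliceTell]
      have hWpos : 0 < W.card := card_pos.2 (nonempty_iff_ne_empty.2 hW0)
      by_cases hKL : (K ∩ lowSet G W).Nonempty
      · -- the clique side announces `v₀`
        rw [leastIn, dif_pos hKL]
        set v₀ := (K ∩ lowSet G W).min' hKL with hv₀
        have hv₀mem : v₀ ∈ K ∩ lowSet G W := min'_mem _ hKL
        have hv₀K : v₀ ∈ K := (mem_inter.1 hv₀mem).1
        have hv₀L : v₀ ∈ lowSet G W := (mem_inter.1 hv₀mem).2
        have hv₀W : v₀ ∈ W := lowSet_subset W hv₀L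
        simp only [DetProtocol.run]
        by_cases hvS : v₀ ∈ S
        · rw [if_pos (decide_eq_true hvS)]
          symm
          rw [decide_eq_false_iff_not]
          exact nonempty_iff_ne_empty.1 ⟨v₀, mem_inter.2 ⟨mem_inter.2 ⟨hv₀K, hvS⟩, hv₀W⟩⟩
        · rw [if_neg (by simpa using hvS), if_pos hv₀L,
            run_cisProtocol hK hS fuel _ (by have := card_nbrWindow_le (G := G) hv₀L; omega),
            ← inter_eq_inter_nbrWindow (W := W) hK hv₀K hvS]
      · -- no low clique node: the stable side announces
        rw [leastIn, dif_neg hKL, run_bobTell]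
        have hKL' : K ∩ lowSet G W = ∅ := not_nonempty_iff_eq_empty.1 hKL
        by_cases hSH : (S ∩ highSet G W).Nonempty
        · rw [leastIn, dif_pos hSH]
          set w₀ := (S ∩ highSet G W).min' hSH with hw₀
          have hw₀mem : w₀ ∈ S ∩ highSet G W := min'_mem _ hSH
          have hw₀S : w₀ ∈ S := (mem_inter.1 hw₀mem).1
          have hw₀H : w₀ ∈ highSet G W := (mem_inter.1 hw₀mem).2
          have hw₀W : w₀ ∈ W := highSet_subset W hw₀H
          simp only [DetProtocol.run]
          by_cases hwK : w₀ ∈ K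
          · rw [if_pos (decide_eq_true hwK)]
            symm
            rw [decide_eq_false_iff_not]
            exact nonempty_iff_ne_empty.1 ⟨w₀, mem_inter.2 ⟨mem_inter.2 ⟨hwK, hw₀S⟩, hw₀W⟩⟩
          · rw [if_neg (by simpa using hwK), if_pos hw₀H,
              run_cisProtocol hK hS fuel _ (by have := card_coNbrWindow_le (G := G) hw₀H; omega),
              ← inter_eq_inter_coNbrWindow (W := W) hS hw₀S hwK]
        · rw [leastIn, dif_neg hSH]
          have hSH' : S ∩ highSet G W = ∅ := not_nonempty_iff_eq_empty.1 hSH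
          simp only [DetProtocol.run]
          symm
          rw [decide_eq_true_iff]
          exact inter_eq_empty_of_degrees hKL' hSH'

/-- `⌊log₂(2m')⌋ + 1 ≤ ⌊log₂(2m)⌋` when `m' ≤ (m−1)/2` and `m ≥ 1` (the halving of the window),
with `⌊log₂ 0⌋ = 0` covering an empty sub-window. [folklore] -/
private theorem log_two_mul_step {m m' : ℕ} (hm : 0 < m) (hm' : m' ≤ (m - 1) / 2) :
    Nat.log 2 (2 * m') + 1 ≤ Nat.log 2 (2 * m) := by
  have h2m : Nat.log 2 (2 * m) = Nat.log 2 m + 1 := by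
    rw [mul_comm]
    exact Nat.log_mul_base one_lt_two (by omega)
  rw [h2m]
  have : Nat.log 2 (2 * m') ≤ Nat.log 2 m := Nat.log_mono_right (by omega)
  omega

/-- **Cost**: the protocol on the window `W` has depth at most `(2·nodeBits n + 1) · ⌊log₂(2|W|)⌋`
(two announcements and one bit per stage; every stage halves the window).
[cite: Yannakakis1991, §5, proof of Lemma 1 (p. 463, "there are at most g stages, and the communication per stage is obviously O(g)")] -/
theorem depth_cisProtocol_le :
    ∀ (fuel : ℕ) (W : Finset (Fin n)),
      (cisProtocol G fuel W).depth ≤ (2 * nodeBits n + 1) * Nat.log 2 (2 * W.card)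
  | 0, W => by simp [cisProtocol, DetProtocol.depth]
  | fuel + 1, W => by
      by_cases hW0 : W = ∅
      · subst hW0
        simp [cisProtocol, DetProtocol.depth]
      rw [cisProtocol, if_neg hW0]
      have hWpos : 0 < W.card := card_pos.2 (nonempty_iff_ne_empty.2 hW0)
      set c := 2 * nodeBits n + 1 with hc
      set E := Nat.log 2 (2 * W.card) with hE
      have hE1 : 1 ≤ E := by
        rw [hE, mul_comm, Nat.log_mul_base one_lt_two (by omega)]
        omega
      -- every recursive call is on a window `W'` with `⌊log₂(2|W'|)⌋ ≤ E − 1`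
      have hrec : ∀ W' : Finset (Fin n), W'.card ≤ (W.card - 1) / 2 →
          (cisProtocol G fuel W').depth ≤ c * (E - 1) := by
        intro W' hW'
        refine (depth_cisProtocol_le fuel W').trans (Nat.mul_le_mul_left c ?_)
        have := log_two_mul_step hWpos hW'
        omega
      set D := c * (E - 1) with hD
      have hbound : nodeBits n + (nodeBits n + 1 + D) ≤ c * E := by
        have : c * (E - 1) + c = c * E := by
          rw [← Nat.mul_succ, Nat.succ_eq_add_one, Nat.sub_add_cancel hE1]
        omega
      refine le_trans (depth_aliceTell_le (γ := Option (Fin n)) _ _ _ _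
        (d := nodeBits n + 1 + D) fun a => ?_) hbound
      rcases a with _ | v
      · -- Bob announces, then Alice answers one bit or the stage recurses
        refine (depth_bobTell_le (γ := Option (Fin n)) _ _ _ _ (d := 1 + D) fun b => ?_).trans
          (by omega)
        rcases b with _ | w
        · simp [DetProtocol.depth]
        · simp only [DetProtocol.depth]
          split_ifs with hw
          · have := hrec _ (card_coNbrWindow_le (G := G) hw)
            omega
          · simp only [DetProtocol.depth]
            omega
      · simp only [DetProtocol.depth]
        split_ifs with hv
        · have := hrec _ (card_nbrWindow_le (G := G) hv)
          omega
        · simp only [DetProtocol.depth]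
          omega

variable (G)

/-- **Yannakakis 1991, Lemma 1 for the predicate `Q` (protocol form): the clique-versus-stable-set
problem of every graph on `n` nodes has a deterministic protocol of depth `O(log² n)`** — explicitly
`≤ (2⌊log₂(n+1)⌋ + 3) · ⌊log₂(2n)⌋` — which accepts the pair (clique `K`, stable set `S`) iff
`K ∩ S = ∅`. [cite: Yannakakis1991, §5, Lemma 1 and its proof (p. 462–463)] -/
theorem Yannakakis1991_lemma1_protocol :
    ∃ P : DetProtocol (Finset (Fin n)) (Finset (Fin n)) Bool,
      P.depth ≤ (2 * (Nat.log 2 (n + 1) + 1) + 1) * Nat.log 2 (2 * n) ∧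
      ∀ K S : Finset (Fin n), G.IsClique (K : Set (Fin n)) → (∀ i ∈ S, ∀ j ∈ S, ¬G.Adj i j) →
        (P.run K S = true ↔ K ∩ S = ∅) := by
  refine ⟨cisProtocol G n univ, ?_, fun K S hK hS => ?_⟩
  · simpa [nodeBits, card_univ, Fintype.card_fin] using depth_cisProtocol_le (G := G) n univ
  · rw [run_cisProtocol hK hS n univ (by simp), inter_univ, decide_eq_true_iff]

end Literature.Computability.Complexity
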